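import Mathlib

/-!
# EisensteinReflection — the `ℤ[ω]` arithmetic behind REMARK AF (iii) and PROP DEG (ii) (solo-blind s81/s82)

Solo-blind programme, `work/s81/referee-closure.md` §3 (PROP DEG) and §6 (REMARK AF), `work/s82/`;
claims SB-C678, SB-C681.  Imports nothing of the programme's tree (Mathlib only).

Informal setting (nothing geometric is formalised here).  For a smooth cubic surface `S` with cubic
threefold `T_S` (the triple cover of `ℙ³` branched along `S`), Allcock–Carlson–Toledo
[ACT, arXiv:math/0007048, (2.3)–(2.7), Thm 4.1, (4.2)] make `Λ = H³(T_S, ℤ)` a module over the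
Eisenstein integers `𝓔 = ℤ[ω]` (`ω` acting as the covering automorphism `σ*`), on which the cup product
`Ω` is a unimodular alternating form with `Ω(ωx, ωy) = Ω(x, y)`, and define the `𝓔`-valued Hermitian form
`h(x,y) = -[Ω(θx, y) + θ·Ω(x, y)]/2`, `θ = ω - ω̄ = √-3` (the first `θ` acting on `Λ`, the second a
scalar); `h` is unimodular of signature `(4,1)`.  Two pieces of pure `ℤ[ω]`-arithmetic are used in
`referee-closure.md`:

* PROP DEG (ii): `h(r,r) = Ω(r, ωr)` (an integer; the imaginary part vanishes), so that the Gram matrix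
  of `Ω` on the rank-two lattice `ℤr ⊕ ℤωr` is `[[0, h(r,r)], [-h(r,r), 0]]` with Pfaffian `h(r,r)`
  — geometrically the `Θ`-degree of the `μ₃`-stable elliptic curve `E_r ⊂ J(T_S)` on the Heegner
  divisor `D_n`, `n = h(r,r)`; and `h(θr, θr) = 3·h(r,r)` (the mirror of `θr` is the mirror of `r`).
* REMARK AF (iii): the complex reflection with root `r` and eigenvalue `ξ ∈ μ₆ ∖ {1}`,
  `R(x) = x - (1 - ξ)·(h(x,r)/h(r,r))·r`, preserves `Λ` iff `(1 - ξ)/n ∈ 𝓔` (given that `h(Λ, r) = 𝓔`,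
  which holds for `r` primitive in a unimodular lattice, and that `𝓔r` is saturated), and
  `(1 - ξ)/n ∈ 𝓔 ⟺ n = 1 ∨ (n = 2 ∧ ξ = -1)`: mirrors of norm `n ≥ 3` carry no reflection of the
  lattice (the direction of Allcock's Lemma 8.1 quoted in [ACT (11.5)] that REMARK AF uses), norm `2`
  only biflections, norm `1` reflections of order `2, 3, 6`.

What this file certifies (closed computations and identities only):
* `Eis` : `𝓔 = ℤ[ω]` as pairs `(a, b) ↦ a + bω` with `ω² = -1 - ω`; norm `a² - ab + b²`;
  `nrm_eq_one_iff`, `exists_inv_iff` : the units are exactly `±1, ±ω, ±ω²`;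
  `nrm_one_sub_units` : `N(1 - ξ) = 0, 4, 3, 1, 3, 1` over `ξ = 1, -1, ω, -ω, ω², -ω²`;
* `unit_reflection_scalar_iff` : for `ξ` a unit `≠ 1` and `n ≥ 1`: `n ∣ (1 - ξ)` in `𝓔`
  (both coordinates divisible by `n`) iff
  `n = 1 ∨ (n = 2 ∧ ξ = -1)` (all `n`, no bound);
* `reflection_integral_iff`, `reflection_integral_iff_units` : the bookkeeping step from
  "`R` preserves `Λ`" to "`n ∣ (1 - ξ)`", over an arbitrary abelian group `Λ` with `ω` acting by an
  endomorphism `w`, the lattice-theoretic inputs (`h(x₀, r) = 1` for some `x₀`; `n·y ∈ 𝓔·r ⇒ n ∣`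
  the coefficient) being HYPOTHESES;
* the symplectic dictionary over an arbitrary abelian group `M` with an alternating bi-additive
  `Ω : M →+ M →+ ℤ` and an additive `w` (hypotheses `Ω(x,x) = 0`, `w² + w + 1 = 0`, `Ω(wx, wy) = Ω(x,y)`
  stated where used): `two_hE` (the defining formula (4.2), denominators cleared), `hE_self` (PROP DEG
  (ii)), `gram_rank_two`, `hE_herm` (Hermitian symmetry), `hE_add_left`, `hE_omega_left`
  (`𝓔`-linearity in the first variable), `hE_theta_self` (`h(θx,θx) = 3h(x,x)`).

Bookkeeping only: no statement about cubic surfaces, threefolds, intermediate Jacobians, ball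
quotients, Hodge classes or the summit is made or implied; the inputs from [ACT] are quoted in this
docstring, not re-proved.
Reference: [ACT] D. Allcock, J. A. Carlson, D. Toledo, The complex hyperbolic geometry of the moduli
space of cubic surfaces, J. Algebraic Geom. 11 (2002) 659–724, arXiv:math/0007048
((2.3)–(2.7) p. 4; Thm 4.1, (4.2) p. 12; (11.2), (11.4)–(11.5) p. 31).
-/

set_option linter.dupNamespace false
set_option autoImplicit false

namespace Summit.HodgeConjecture.HodgeConjecture.Theorems.EisensteinReflection

/-- The Eisenstein integers `𝓔 = ℤ[ω]` (`ω² + ω + 1 = 0`), modelled as pairs `(a, b) ↦ a + bω`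
(`𝓔` is free over `ℤ` on `1, ω`). -/
@[ext]
structure Eis where
  /-- coefficient of `1` -/
  a : ℤ
  /-- coefficient of `ω` -/
  b : ℤ
deriving DecidableEq

namespace Eis

/-- `0 = 0 + 0ω`. -/
instance : Zero Eis := ⟨⟨0, 0⟩⟩
/-- `1 = 1 + 0ω`. -/
instance : One Eis := ⟨⟨1, 0⟩⟩
/-- coordinatewise addition. -/
instance : Add Eis := ⟨fun z w => ⟨z.a + w.a, z.b + w.b⟩⟩
/-- coordinatewise negation. -/
instance : Neg Eis := ⟨fun z => ⟨-z.a, -z.b⟩⟩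
/-- coordinatewise subtraction. -/
instance : Sub Eis := ⟨fun z w => ⟨z.a - w.a, z.b - w.b⟩⟩
/-- `(a + bω)(c + dω) = (ac - bd) + (ad + bc - bd)ω`, using `ω² = -1 - ω`. -/
instance : Mul Eis := ⟨fun z w => ⟨z.a * w.a - z.b * w.b, z.a * w.b + z.b * w.a - z.b * w.b⟩⟩

/-- coordinate of `0`. -/ @[simp] theorem zero_a : (0 : Eis).a = 0 := rfl
/-- coordinate of `0`. -/ @[simp] theorem zero_b : (0 : Eis).b = 0 := rfl
/-- coordinate of `1`. -/ @[simp] theorem one_a : (1 : Eis).a = 1 := rfl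
/-- coordinate of `1`. -/ @[simp] theorem one_b : (1 : Eis).b = 0 := rfl
/-- coordinate of a sum. -/ @[simp] theorem add_a (z w : Eis) : (z + w).a = z.a + w.a := rfl
/-- coordinate of a sum. -/ @[simp] theorem add_b (z w : Eis) : (z + w).b = z.b + w.b := rfl
/-- coordinate of a negative. -/ @[simp] theorem neg_a (z : Eis) : (-z).a = -z.a := rfl
/-- coordinate of a negative. -/ @[simp] theorem neg_b (z : Eis) : (-z).b = -z.b := rfl
/-- coordinate of a difference. -/ @[simp] theorem sub_a (z w : Eis) : (z - w).a = z.a - w.a := rfl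
/-- coordinate of a difference. -/ @[simp] theorem sub_b (z w : Eis) : (z - w).b = z.b - w.b := rfl
/-- coordinate of a product. -/
@[simp] theorem mul_a (z w : Eis) : (z * w).a = z.a * w.a - z.b * w.b := rfl
/-- coordinate of a product. -/
@[simp] theorem mul_b (z w : Eis) : (z * w).b = z.a * w.b + z.b * w.a - z.b * w.b := rfl

/-- `ω`. -/
def omegaE : Eis := ⟨0, 1⟩
/-- `θ = ω - ω̄ = 1 + 2ω` (`θ² = -3`). -/
def thetaE : Eis := ⟨1, 2⟩
/-- complex conjugation `a + bω ↦ a + bω̄ = (a - b) - bω`. -/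
def bar (z : Eis) : Eis := ⟨z.a - z.b, -z.b⟩
/-- the norm `N(a + bω) = a² - ab + b² = z·z̄`. -/
def nrm (z : Eis) : ℤ := z.a * z.a - z.a * z.b + z.b * z.b
/-- the integer `n` as an element of `𝓔`. -/
def ofInt (n : ℤ) : Eis := ⟨n, 0⟩
/-- `n·z` for an integer `n`. -/
def scale (n : ℤ) (z : Eis) : Eis := ⟨n * z.a, n * z.b⟩
/-! `z/n ∈ 𝓔` for an integer `n` (i.e. `n ∣ z` in `𝓔`) is written throughout as
`n ∣ z.a ∧ n ∣ z.b` — both coordinates divisible, `𝓔` being free on `1, ω`. -/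
/-- the six units `1, -1, ω, -ω, ω² = -1 - ω, -ω² = 1 + ω`. -/
def units6 : List Eis := [⟨1, 0⟩, ⟨-1, 0⟩, ⟨0, 1⟩, ⟨0, -1⟩, ⟨-1, -1⟩, ⟨1, 1⟩]

/-- `z · 1 = z`. -/
theorem mul_one' (z : Eis) : z * 1 = z := by
  ext <;> simp

/-- `ω³ = 1` and `ω² = -1 - ω`. -/
theorem omegaE_cube : omegaE * omegaE * omegaE = 1 ∧ omegaE * omegaE = ⟨-1, -1⟩ := by
  decide

/-- `θ = ω - ω̄`, `θ² = -3`, `N(θ) = 3`. -/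
theorem thetaE_facts : thetaE = omegaE - bar omegaE ∧ thetaE * thetaE = ofInt (-3) ∧ nrm thetaE = 3 := by
  decide

/-- `z · z̄ = N(z)`. -/
theorem mul_bar (z : Eis) : z * bar z = ofInt (nrm z) := by
  ext <;> simp [bar, nrm, ofInt] <;> ring

/-- the norm is multiplicative. -/
theorem nrm_mul (z w : Eis) : nrm (z * w) = nrm z * nrm w := by
  simp [nrm]; ring

/-- `4·N(a + bω) = (2a - b)² + 3b²`, so the norm is non-negative. -/
theorem nrm_nonneg (z : Eis) : 0 ≤ nrm z := by
  have h : 4 * nrm z = (2 * z.a - z.b) ^ 2 + 3 * z.b ^ 2 := by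
    simp [nrm]; ring
  nlinarith [sq_nonneg (2 * z.a - z.b), sq_nonneg z.b]

/-- (scaling commutes with multiplication) `(n·q)·u = n·(q·u)`. -/
theorem scale_mul (n : ℤ) (q u : Eis) : scale n q * u = scale n (q * u) := by
  ext <;> simp [scale] <;> ring

/-- `n ∣ z` in `𝓔` iff `z = n·q` for some `q ∈ 𝓔`. -/
theorem intDvd_iff_exists_scale (n : ℤ) (z : Eis) :
    (n ∣ z.a ∧ n ∣ z.b) ↔ ∃ q, z = scale n q := by
  constructor
  · rintro ⟨⟨p, hp⟩, ⟨q, hq⟩⟩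
    exact ⟨⟨p, q⟩, Eis.ext hp hq⟩
  · rintro ⟨q, rfl⟩
    exact ⟨⟨q.a, rfl⟩, ⟨q.b, rfl⟩⟩

/-- THE UNITS OF `𝓔`: `N(z) = 1` iff `z ∈ {±1, ±ω, ±ω²}` (from `4 = (2a - b)² + 3b² = (2b - a)² + 3a²`
both coordinates lie in `[-1, 1]`, then nine cases). -/
theorem nrm_eq_one_iff (z : Eis) : nrm z = 1 ↔ z ∈ units6 := by
  obtain ⟨a, b⟩ := z
  constructor
  · intro h
    simp only [nrm] at h
    have i1 : (2 * a - b) ^ 2 + 3 * b ^ 2 = 4 := by nlinarith [h]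
    have i2 : (2 * b - a) ^ 2 + 3 * a ^ 2 = 4 := by nlinarith [h]
    have hb1 : b ≤ 1 := by nlinarith [sq_nonneg (2 * a - b), sq_nonneg (b - 2)]
    have hb2 : -1 ≤ b := by nlinarith [sq_nonneg (2 * a - b), sq_nonneg (b + 2)]
    have ha1 : a ≤ 1 := by nlinarith [sq_nonneg (2 * b - a), sq_nonneg (a - 2)]
    have ha2 : -1 ≤ a := by nlinarith [sq_nonneg (2 * b - a), sq_nonneg (a + 2)]
    interval_cases a <;> interval_cases b <;> simp_all [units6]
  · intro h
    simp only [units6, List.mem_cons, List.mem_nil_iff, or_false, Eis.mk.injEq] at h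
    rcases h with ⟨rfl, rfl⟩ | ⟨rfl, rfl⟩ | ⟨rfl, rfl⟩ | ⟨rfl, rfl⟩ | ⟨rfl, rfl⟩ | ⟨rfl, rfl⟩ <;> decide

/-- `z` is invertible in `𝓔` iff `z ∈ {±1, ±ω, ±ω²}` (inverse = conjugate). -/
theorem exists_inv_iff (z : Eis) : (∃ z', z * z' = 1) ↔ z ∈ units6 := by
  rw [← nrm_eq_one_iff]
  constructor
  · rintro ⟨z', h⟩
    have h1 : nrm z * nrm z' = 1 := by rw [← nrm_mul, h]; decide
    have h0 := nrm_nonneg z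
    have h0' := nrm_nonneg z'
    rcases (show nrm z ≤ 0 ∨ nrm z = 1 ∨ 2 ≤ nrm z by omega) with h2 | h2 | h2
    · have e : nrm z = 0 := by omega
      rw [e, zero_mul] at h1
      exact absurd h1 (by norm_num)
    · exact h2
    · exfalso
      rcases (show nrm z' ≤ 0 ∨ 1 ≤ nrm z' by omega) with h3 | h3
      · have e : nrm z' = 0 := by omega
        rw [e, mul_zero] at h1
        exact absurd h1 (by norm_num)
      · nlinarith
  · intro h
    exact ⟨bar z, by rw [mul_bar, h]; rfl⟩

/-- the norms `N(1 - ξ)` over the six units `ξ = 1, -1, ω, -ω, ω², -ω²`: `0, 4, 3, 1, 3, 1`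
(so `n ∣ (1 - ξ)` forces `n² ∣ N(1 - ξ) ≤ 4`). -/
theorem nrm_one_sub_units : (units6.map fun ξ => nrm (1 - ξ)) = [0, 4, 3, 1, 3, 1] := by
  decide

/-- an integer `n ≥ 3` divides no integer `c ≠ 0` with `|c| ≤ 2`. -/
theorem eq_zero_of_dvd_of_abs_le_two {n c : ℤ} (hn : 3 ≤ n) (hc1 : -2 ≤ c) (hc2 : c ≤ 2)
    (hd : n ∣ c) : c = 0 := by
  obtain ⟨k, rfl⟩ := hd
  rcases (show k ≤ -1 ∨ k = 0 ∨ 1 ≤ k by omega) with hk | rfl | hk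
  · nlinarith
  · simp
  · nlinarith

/-- REMARK AF (iii), the arithmetic kernel: for a unit `ξ ≠ 1` of `𝓔` and an integer `n ≥ 1`,
`(1 - ξ)/n ∈ 𝓔` iff `n = 1`, or `n = 2` and `ξ = -1`.  (All `n`; for `n ≥ 3` both coordinates of
`1 - ξ` lie in `[-2, 2]` and would have to vanish.) -/
theorem unit_reflection_scalar_iff (ξ : Eis) (hξ : ξ ∈ units6) (hξ1 : ξ ≠ 1) {n : ℤ} (hn : 1 ≤ n) :
    (n ∣ (1 - ξ).a ∧ n ∣ (1 - ξ).b) ↔ n = 1 ∨ (n = 2 ∧ ξ = ⟨-1, 0⟩) := by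
  have hξ' : ξ = ⟨1, 0⟩ ∨ ξ = ⟨-1, 0⟩ ∨ ξ = ⟨0, 1⟩ ∨ ξ = ⟨0, -1⟩ ∨ ξ = ⟨-1, -1⟩ ∨ ξ = ⟨1, 1⟩ := by
    simpa [units6] using hξ
  rcases (show n = 1 ∨ n = 2 ∨ 3 ≤ n by omega) with rfl | rfl | h3
  · simp
  · rcases hξ' with rfl | rfl | rfl | rfl | rfl | rfl
    · exact absurd rfl hξ1
    all_goals norm_num
  · have hc : -2 ≤ (1 - ξ).a ∧ (1 - ξ).a ≤ 2 ∧ -2 ≤ (1 - ξ).b ∧ (1 - ξ).b ≤ 2 := by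
      rcases hξ' with rfl | rfl | rfl | rfl | rfl | rfl <;> simp
    constructor
    · rintro ⟨h1, h2⟩
      have e1 := eq_zero_of_dvd_of_abs_le_two h3 hc.1 hc.2.1 h1
      have e2 := eq_zero_of_dvd_of_abs_le_two h3 hc.2.2.1 hc.2.2.2 h2
      simp only [sub_a, sub_b, one_a, one_b] at e1 e2
      exact absurd (Eis.ext (by simp only [one_a]; omega) (by simp only [one_b]; omega)) hξ1
    · rintro (h | ⟨h, -⟩) <;> omega

section Reflection

variable {Λ : Type*} [AddCommGroup Λ]

/-- The action of `z = a + bω ∈ 𝓔` on an abelian group `Λ` on which `ω` acts by the endomorphism `w`: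
`z·v = a·v + b·w(v)`. -/
def act (w : Λ →+ Λ) (z : Eis) (v : Λ) : Λ := z.a • v + z.b • w v

/-- `(n·z)·v = n·(z·v)`. -/
theorem act_scale (w : Λ →+ Λ) (n : ℤ) (z : Eis) (v : Λ) : act w (scale n z) v = n • act w z v := by
  simp [act, scale, mul_smul, smul_add]

/-- REMARK AF (iii), the bookkeeping step.  Let `h : Λ → Λ → 𝓔` be any pairing, `r ∈ Λ`, `n ∈ ℤ`
(think `n = h(r,r)`), `ξ ∈ 𝓔`.  Assume (unimodularity + primitivity of `r`) that `h(x₀, r) = 1` for some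
`x₀`, and (saturation of `𝓔r`) that `n·y = z·r` forces `n ∣ z`.  Then the reflection
`R(x) = x - (1 - ξ)(h(x,r)/n)·r` takes `Λ` to `Λ` — i.e. `(1 - ξ)h(x,r)·r ∈ n·Λ` for every `x` — iff
`n ∣ (1 - ξ)` in `𝓔`. -/
theorem reflection_integral_iff (w : Λ →+ Λ) (h : Λ → Λ → Eis) (r : Λ) (n : ℤ) (ξ : Eis)
    (hsurj : ∃ x₀, h x₀ r = 1)
    (hprim : ∀ z : Eis, (∃ y : Λ, n • y = act w z r) → n ∣ z.a ∧ n ∣ z.b) :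
    (∀ x, ∃ y : Λ, n • y = act w ((1 - ξ) * h x r) r) ↔ (n ∣ (1 - ξ).a ∧ n ∣ (1 - ξ).b) := by
  constructor
  · intro H
    obtain ⟨x₀, hx₀⟩ := hsurj
    obtain ⟨y, hy⟩ := H x₀
    rw [hx₀, mul_one'] at hy
    exact hprim _ ⟨y, hy⟩
  · intro hd x
    obtain ⟨q, hq⟩ := (intDvd_iff_exists_scale _ _).mp hd
    refine ⟨act w (q * h x r) r, ?_⟩
    rw [hq, scale_mul, act_scale]

/-- REMARK AF (iii) assembled: under the same two hypotheses, for a unit `ξ ≠ 1` and `n ≥ 1` the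
reflection with root `r` and eigenvalue `ξ` preserves `Λ` iff `n = 1`, or `n = 2` and `ξ = -1`
(a biflection): mirrors of norm `n ≥ 3` carry no reflection of the lattice. -/
theorem reflection_integral_iff_units (w : Λ →+ Λ) (h : Λ → Λ → Eis) (r : Λ) {n : ℤ} (hn : 1 ≤ n)
    (ξ : Eis) (hξ : ξ ∈ units6) (hξ1 : ξ ≠ 1)
    (hsurj : ∃ x₀, h x₀ r = 1)
    (hprim : ∀ z : Eis, (∃ y : Λ, n • y = act w z r) → n ∣ z.a ∧ n ∣ z.b) :
    (∀ x, ∃ y : Λ, n • y = act w ((1 - ξ) * h x r) r) ↔ n = 1 ∨ (n = 2 ∧ ξ = ⟨-1, 0⟩) :=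
  (reflection_integral_iff w h r n ξ hsurj hprim).trans (unit_reflection_scalar_iff ξ hξ hξ1 hn)

end Reflection

end Eis

open Eis

section Symplectic

variable {M : Type*} [AddCommGroup M] (Ω : M →+ M →+ ℤ) (w : M →+ M)

/-- `θ = ω - ω̄` acting on `M`: since `ω̄ = ω² = -1 - ω` this is `x ↦ x + 2ω(x)` (see `thetaAct_eq`). -/
def thetaAct (x : M) : M := x + (w x + w x)

/-- ACT's form in the coordinates `(1, ω)` of `𝓔`:
`h(x,y) = -[Ω(θx,y) + θΩ(x,y)]/2 = -(Ω(x,y) + Ω(ωx,y)) - Ω(x,y)·ω` (see `two_hE`). -/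
def hE (x y : M) : Eis := ⟨-(Ω x y + Ω (w x) y), -Ω x y⟩

/-- an alternating form is antisymmetric. -/
theorem Omega_antisymm (halt : ∀ x, Ω x x = 0) (x y : M) : Ω y x = -Ω x y := by
  have h := halt (x + y)
  simp only [map_add, AddMonoidHom.add_apply, halt, zero_add, add_zero] at h
  omega

/-- `ω² + ω + 1 = 0` on `M`: `ω̄ = ω² = -1 - ω`. -/
theorem wbar_eq (hw : ∀ x, w (w x) + w x + x = 0) (x : M) : w (w x) = -x - w x := by
  have h := hw x
  calc w (w x) = (w (w x) + w x + x) - x - w x := by abel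
    _ = -x - w x := by rw [h]; abel

/-- `θx = ωx - ω̄x = x + 2ωx`. -/
theorem thetaAct_eq (hw : ∀ x, w (w x) + w x + x = 0) (x : M) : w x - w (w x) = thetaAct w x := by
  rw [wbar_eq w hw x, thetaAct]; abel

/-- [ACT (4.2)] with denominators cleared: `2h(x,y) = -(Ω(θx,y) + θ·Ω(x,y))` in `𝓔`
(no hypothesis on `Ω`, `w` needed). -/
theorem two_hE (x y : M) :
    hE Ω w x y + hE Ω w x y = -(ofInt (Ω (thetaAct w x) y) + thetaE * ofInt (Ω x y)) := by
  ext <;> simp [hE, thetaAct, ofInt, thetaE, map_add, AddMonoidHom.add_apply] <;> ring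

/-- PROP DEG (ii): `h(r,r) = Ω(r, ωr)`, an integer (the `ω`-coordinate vanishes). -/
theorem hE_self (halt : ∀ x, Ω x x = 0) (r : M) : hE Ω w r r = ofInt (Ω r (w r)) := by
  have a1 := Omega_antisymm Ω halt r (w r)
  ext <;> simp [hE, ofInt, halt, a1]

/-- The Gram matrix of `Ω` on `(r, ωr)` is `[[0, h(r,r)], [-h(r,r), 0]]`: its Pfaffian is `h(r,r)`
(informally: the polarisation degree of the rank-two sublattice `ℤr ⊕ ℤωr = 𝓔r` is `|h(r,r)|`). -/
theorem gram_rank_two (halt : ∀ x, Ω x x = 0) (r : M) :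
    Ω r r = 0 ∧ Ω (w r) (w r) = 0 ∧ Ω r (w r) = (hE Ω w r r).a ∧ Ω (w r) r = -(hE Ω w r r).a := by
  have a1 := Omega_antisymm Ω halt r (w r)
  refine ⟨halt r, halt (w r), ?_, ?_⟩ <;> simp [hE, halt, a1]

/-- the isometry relation `Ω(ωx, y) + Ω(x, ωy) + Ω(x, y) = 0` (from `Ω(ωx, ωy) = Ω(x,y)` and
`ω² = -1 - ω`). -/
theorem Omega_omega_rel (hw : ∀ x, w (w x) + w x + x = 0) (hiso : ∀ x y, Ω (w x) (w y) = Ω x y)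
    (x y : M) : Ω (w x) y + Ω x (w y) + Ω x y = 0 := by
  have h1 : Ω (w x) y = Ω (w (w x)) (w y) := (hiso (w x) y).symm
  rw [wbar_eq w hw x] at h1
  simp only [map_sub, map_neg, AddMonoidHom.sub_apply, AddMonoidHom.neg_apply, hiso] at h1
  omega

/-- `h` is Hermitian: `h(y,x) = conj h(x,y)`. -/
theorem hE_herm (halt : ∀ x, Ω x x = 0) (hw : ∀ x, w (w x) + w x + x = 0)
    (hiso : ∀ x y, Ω (w x) (w y) = Ω x y) (x y : M) : hE Ω w y x = bar (hE Ω w x y) := by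
  have k := Omega_omega_rel Ω w hw hiso x y
  have a1 := Omega_antisymm Ω halt x y
  have a2 := Omega_antisymm Ω halt x (w y)
  ext <;> simp only [hE, bar, a1, a2]
  all_goals omega

/-- `h` is additive in the first variable. -/
theorem hE_add_left (x x' y : M) : hE Ω w (x + x') y = hE Ω w x y + hE Ω w x' y := by
  ext <;> simp [hE, map_add, AddMonoidHom.add_apply] <;> ring

/-- `h` is `𝓔`-linear in the first variable: `h(ωx, y) = ω·h(x,y)`. -/
theorem hE_omega_left (hw : ∀ x, w (w x) + w x + x = 0) (x y : M) :
    hE Ω w (w x) y = omegaE * hE Ω w x y := by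
  have e := wbar_eq w hw x
  ext <;> simp [hE, omegaE, e, map_sub, map_neg, AddMonoidHom.sub_apply, AddMonoidHom.neg_apply]

/-- `h(θx, θx) = 3·h(x,x)`: the root `θr` defines the same mirror as `r` with the norm tripled
(PROP DEG, Remark). -/
theorem hE_theta_self (halt : ∀ x, Ω x x = 0) (hw : ∀ x, w (w x) + w x + x = 0) (x : M) :
    hE Ω w (thetaAct w x) (thetaAct w x) = scale 3 (hE Ω w x x) := by
  have e := wbar_eq w hw x
  have a1 := Omega_antisymm Ω halt x (w x)
  ext <;> simp [hE, thetaAct, scale, e, halt, a1, map_add, map_sub, map_neg, AddMonoidHom.add_apply,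
    AddMonoidHom.sub_apply, AddMonoidHom.neg_apply]
  all_goals omega

end Symplectic

end Summit.HodgeConjecture.HodgeConjecture.Theorems.EisensteinReflection
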